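import Summits.AtomisticToContinuum.Crystallization.Theorems.ChartedZeroExcessLayeredLatticeLiouvilleZZZYREB
import Summits.AtomisticToContinuum.Crystallization.Theorems.ChartedZeroExcessLayeredLatticeLiouvilleZZZYRE

/-!
# Charted zero-excess layered-lattice Liouville — ZZZYRF: the TWIN RE-INDEXING TRANSFER (index-norm re-indexing of a layered presentation
transports `Layered`, `IsLayeredCrystal`, `CoerciveZ` with explicit constants) and the COARSE RE-CHART `CoarseRechartP` from the
identification leaf `TwinChartP`

Cell `decomp-a2c`, lens 2 («special vs generic»), generation 101.  Line (D), binder `UniformEquilStabilityAt`; critic r1880 (α) (windowed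
target), r1882 (C) / r1891 (instance of record: fine window, coarse re-chart via ZZZYRE `uniformEquilStabilityAt_of_fine_coarse`).
ZZZYRE isolated the coarse stratum of Λ = 2 as `CoarseRechartP s Λ κ₀ c₀ κ' c' Wf Wc` («fine windowed stability ⇒ coarse windowed stability
with degraded constants»); ZZZYREB exhibited the index-4 twin of a chart.  This file PROVES the structural half and leaves ONE identification leaf:
§0 `idxNorm_le_iff`. §1 ★ REGROUPING `sum_normSq_le_of_idxNorm_le`: a finite sum of `‖φ Y − φ X‖²` over pairs of index offset `≤ r` is
   `≤ 10 r² (2r+1)³ · nnFormZ φ` (fibres over the offset `v ∈ idxBox r`, each `≤ dispSq φ v ≤ 10 N(v)² nnFormZ φ`, UV/UW).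
§2 ★★ ABSTRACT RE-INDEXING TRANSFER along an index bijection `Φ : Cell 2 × ℤ ≃ Cell 2 × ℤ` with `lsite G₁ G₂ w' X = lsite g₁ g₂ wf (Φ X)`:
   (R1) `layered_eq_of_reindex` (same point set), (R2) `isLayeredCrystal_of_reindex` (co-Lipschitz `c ↦ c / D` under index dilation `D`),
   (R3) `nnFormZ_le_of_reindex` (`nnFormZ φ ≤ 10 r² (2r+1)³ · nnFormZ (pullback Φ φ)` under adjacency radius `r`, by §1), (R4)
   `coerciveZ_of_reindex` (coercivity `κ ↦ κ / (10 r² (2r+1)³)`: the quadratic form is re-indexed by `Equiv.hasSum_iff (Equiv.prodCongr Φ Φ)`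
   — the bond kernel `layeredKernel` depends on the two SITES only, `layeredKernel_sub_fst_eq` — then (R3)).
§3 the INDEX-4 twin `twinIdx₄ (γ, m) = (2γ + (m%4%2, m%4/2), m/4)` (generators `2g₁, 2g₂`, offsets `twinOff₄` = ZZZYREB's `doubleOffsets` on
   generators): dilation 7 (coarse layers `m`, `m+7` are fine-adjacent), adjacency radius 3 ⇒ `c/7`, `κ/30870` — numerals PROVED (omega).
§4 the INDEX-3 twin `twinIdx₃ (γ, m) = ((γ₀ − γ₁ + m%3, γ₀ + 2γ₁), m/3)` (generators `g₁ + g₂, −g₁ + 2g₂` = √3·R₃₀,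
   offsets `twinOff₃`): dilation 5, radius 4 ⇒ `c/5`, `κ/116640` (the integrality step `3|Δγ₁| ≤ 2N+2` is handed to omega explicitly).
§5 ★ `IsTwinGen`, the leaf `TwinChartP s Λ Wf Wc` («every equilibrium chart at a coarse scale `a ∈ Wc` has a FINE equilibrium chart, scale
   in `Wf`, with the same atom set and twin-related generators») — CELL-ID · WEAKER · UNDECIDED, test PLANE-COMPLETE from
   `IsTwoShellGoodSet (1/16) (9/10) 1` — ★★ `coarseRechartP_of_twinChart : 0 ≤ κ₀ → 0 ≤ c₀ → TwinChartP s Λ Wf Wc →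
   CoarseRechartP s Λ κ₀ c₀ (κ₀/116640) (c₀/7) Wf Wc` and ★★ `uniformEquilStabilityAt_of_fine_twin`: fine windowed stability + `TwinChartP`
   + `ChartScaleCoverP` (ZZZYRE; arithmetic leaf, test «Löschian indices 1, 3, 4 only below a(1−s) ≤ Λ», needs (W2) √6·amin > 2) ⇒
   `UniformEquilStabilityAt s Λ (min κ₀ (κ₀/116640)) (min c₀ (c₀/7))`; designate (s, Λ, c₀) = (1/50, 2, 1/2): binder of record
   `UniformEquilStabilityAt (1/50) 2 (min κ₀ (κ₀/116640)) (min (1/2) (1/14))` (r1891; W_fine = Icc amin amax PROVISIONAL [0.827, 1.09] under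
   (W1) amax/amin < √3, (W2) amin > 2/√6; ZZZYRE's docstring «c′ = c₀/3» is the erratum of record).
Theorem file; imports ZZZYREB, ZZZYRE; no instance / notation / option; 0 sorry. [g101]
-/

namespace Summit.AtomisticToContinuum.Crystallization.Theorems.ChartedZeroExcessLayeredLatticeLiouville

open scoped BigOperators RealInnerProductSpace
open Summit.AtomisticToContinuum.Crystallization.Theorems.ChartedPlanarOrderRigidityDoor (E3)
open Summit.AtomisticToContinuum.Crystallization.Theorems.ChartedPlanarOrderMesoCut (LayeredHom)
open Summit.AtomisticToContinuum.Crystallization.Theorems.ChartedPlanarOrderDoorLayered (Layered)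
open Literature.MathematicalPhysics.StatisticalMechanics (triangularVec₁ triangularVec₂)

/-! ### §0 index-norm bookkeeping -/

/-- the index sup-norm bound, component by component. [g101] -/
theorem idxNorm_le_iff {v : Cell 2 × ℤ} {n : ℕ} :
    idxNorm v ≤ n ↔ (v.1 0).natAbs ≤ n ∧ (v.1 1).natAbs ≤ n ∧ v.2.natAbs ≤ n := by
  unfold idxNorm; simp only [max_le_iff, and_assoc]

/-! ### §1 regrouping a sum of squared displacements by the index offset -/

/-- ★ REGROUPING: if `φ` vanishes off the finset `S` and every pair of `T` has index offset at most `r`, then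
`Σ_{(X,Y) ∈ T} ‖φ Y − φ X‖² ≤ 10 r² (2r+1)³ · nnFormZ φ`. [g101] -/
theorem sum_normSq_le_of_idxNorm_le {S : Finset (Cell 2 × ℤ)} {φ : Cell 2 → ℤ → E3}
    (hS : ∀ U : Cell 2 × ℤ, U ∉ S → φ U.1 U.2 = 0) (r : ℕ) (T : Finset ((Cell 2 × ℤ) × (Cell 2 × ℤ)))
    (hT : ∀ y ∈ T, idxNorm (y.2 - y.1) ≤ r) :
    ∑ y ∈ T, ‖φ y.2.1 y.2.2 - φ y.1.1 y.1.2‖ ^ 2 ≤ 10 * (r : ℝ) ^ 2 * (2 * r + 1) ^ 3 * nnFormZ φ := by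
  classical
  have hN := nnFormZ_nonneg φ
  have hfib : ∑ y ∈ T, ‖φ y.2.1 y.2.2 - φ y.1.1 y.1.2‖ ^ 2 =
      ∑ v ∈ T.image (fun x => x.2 - x.1), ∑ x ∈ T with x.2 - x.1 = v, ‖φ x.2.1 x.2.2 - φ x.1.1 x.1.2‖ ^ 2 :=
    (Finset.sum_fiberwise_of_maps_to (fun x hx => Finset.mem_image_of_mem (fun x => x.2 - x.1) hx) _).symm
  have hinner : ∀ v : Cell 2 × ℤ, ∑ x ∈ T with x.2 - x.1 = v, ‖φ x.2.1 x.2.2 - φ x.1.1 x.1.2‖ ^ 2 ≤ dispSq φ v := by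
    intro v
    have h1 : ∑ x ∈ T with x.2 - x.1 = v, ‖φ x.2.1 x.2.2 - φ x.1.1 x.1.2‖ ^ 2 =
        ∑ x ∈ T with x.2 - x.1 = v, dispSqFam φ v x.1 := by
      refine Finset.sum_congr rfl fun x hx => ?_
      have hxv : x.2 - x.1 = v := (Finset.mem_filter.mp hx).2
      rw [← hxv, dispSqFam_sub_fst]
    have hinj : Set.InjOn (fun x : (Cell 2 × ℤ) × (Cell 2 × ℤ) => x.1) ↑(T.filter fun x => x.2 - x.1 = v) := by
      intro x hx y hy hxy
      have hx' : x.2 - x.1 = v := (Finset.mem_filter.mp (Finset.mem_coe.mp hx)).2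
      have hy' : y.2 - y.1 = v := (Finset.mem_filter.mp (Finset.mem_coe.mp hy)).2
      have ex : x.2 = x.1 + v := by rw [← hx', add_sub_cancel]
      have ey : y.2 = y.1 + v := by rw [← hy', add_sub_cancel]
      have hxy' : x.1 = y.1 := hxy
      exact Prod.ext hxy' (by rw [ex, ey, hxy'])
    have h2 : ∑ x ∈ T with x.2 - x.1 = v, dispSqFam φ v x.1 =
        ∑ U ∈ (T.filter fun x => x.2 - x.1 = v).image (fun x => x.1), dispSqFam φ v U :=
      (Finset.sum_image hinj).symm
    rw [h1, h2]
    exact sum_le_finsum_of_nonneg _ (fun U => dispSqFam_nonneg φ v U) (support_dispSqFam_finite hS v)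
  have hsub : T.image (fun x => x.2 - x.1) ⊆ idxBox r := fun v hv => by
    obtain ⟨y, hy, rfl⟩ := Finset.mem_image.mp hv; exact mem_idxBox (hT y hy)
  have hbd : ∀ v ∈ T.image (fun x => x.2 - x.1), dispSq φ v ≤ 10 * (r : ℝ) ^ 2 * nnFormZ φ := by
    intro v hv
    obtain ⟨y, hy, rfl⟩ := Finset.mem_image.mp hv
    have hr : (idxNorm (y.2 - y.1) : ℝ) ≤ r := by exact_mod_cast hT y hy
    calc dispSq φ (y.2 - y.1) ≤ 10 * (idxNorm (y.2 - y.1) : ℝ) ^ 2 * nnFormZ φ := dispSq_le_idxNorm_sq hS _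
      _ ≤ 10 * (r : ℝ) ^ 2 * nnFormZ φ :=
          mul_le_mul_of_nonneg_right (mul_le_mul_of_nonneg_left (pow_le_pow_left₀ (by positivity) hr 2) (by norm_num)) hN
  have hcard : ((T.image (fun x => x.2 - x.1)).card : ℝ) ≤ (2 * r + 1) ^ 3 := by
    have h := Finset.card_le_card hsub; rw [card_idxBox] at h; exact_mod_cast h
  calc ∑ y ∈ T, ‖φ y.2.1 y.2.2 - φ y.1.1 y.1.2‖ ^ 2
      = ∑ v ∈ T.image (fun x => x.2 - x.1), ∑ x ∈ T with x.2 - x.1 = v, ‖φ x.2.1 x.2.2 - φ x.1.1 x.1.2‖ ^ 2 := hfib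
    _ ≤ ∑ v ∈ T.image (fun x => x.2 - x.1), 10 * (r : ℝ) ^ 2 * nnFormZ φ :=
        Finset.sum_le_sum fun v hv => (hinner v).trans (hbd v hv)
    _ = (T.image (fun x => x.2 - x.1)).card * (10 * (r : ℝ) ^ 2 * nnFormZ φ) := by rw [Finset.sum_const, nsmul_eq_mul]
    _ ≤ (2 * r + 1) ^ 3 * (10 * (r : ℝ) ^ 2 * nnFormZ φ) := mul_le_mul_of_nonneg_right hcard (by positivity)
    _ = 10 * (r : ℝ) ^ 2 * (2 * r + 1) ^ 3 * nnFormZ φ := by ring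

/-! ### §2 the abstract re-indexing transfer -/

section Reindex

variable {g₁ g₂ G₁ G₂ : E3} {wf w' : ℤ → E3} (Φ : Cell 2 × ℤ ≃ Cell 2 × ℤ)
  (hsite : ∀ X : Cell 2 × ℤ, lsite G₁ G₂ w' X.1 X.2 = lsite g₁ g₂ wf (Φ X).1 (Φ X).2)
include hsite

/-- (R1) ★ SAME POINT SET: a re-indexed presentation has the same layered set. [g101] -/
theorem layered_eq_of_reindex : Layered G₁ G₂ w' = Layered g₁ g₂ wf := by
  rw [layered_eq_range, layered_eq_range]
  have h : (fun x : Cell 2 × ℤ => lsite G₁ G₂ w' x.1 x.2) = (fun x : Cell 2 × ℤ => lsite g₁ g₂ wf x.1 x.2) ∘ Φ :=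
    funext fun x => hsite x
  rw [h, Φ.surjective.range_comp]

/-- (R2) ★ CO-LIPSCHITZ TRANSFER: under index dilation `D` (`N(Y − X) ≤ D · N(Φ Y − Φ X)`) the co-Lipschitz constant degrades by `D`. [g101] -/
theorem isLayeredCrystal_of_reindex {D : ℕ} (hD : 0 < D)
    (hdil : ∀ X Y : Cell 2 × ℤ, idxNorm (Y - X) ≤ D * idxNorm (Φ Y - Φ X)) {c : ℝ} (hc : 0 ≤ c)
    (h : IsLayeredCrystal c g₁ g₂ wf) : IsLayeredCrystal (c / D) G₁ G₂ w' := by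
  intro X Y
  rw [hsite X, hsite Y]
  have h1 := h (Φ X) (Φ Y)
  have h2 : dist X Y ≤ D * dist (Φ X) (Φ Y) := by
    rw [dist_eq_idxNorm, dist_eq_idxNorm]; exact_mod_cast hdil X Y
  have hDr : (0 : ℝ) < D := by exact_mod_cast hD
  calc c / D * dist X Y ≤ c / D * (D * dist (Φ X) (Φ Y)) := mul_le_mul_of_nonneg_left h2 (div_nonneg hc hDr.le)
    _ = c * dist (Φ X) (Φ Y) := by field_simp
    _ ≤ _ := h1

/-- the PULLED-BACK displacement field along `Φ` (`(pullback Φ φ) (Φ X) = φ X`). [g101] -/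
def pullback (φ : Cell 2 → ℤ → E3) : Cell 2 → ℤ → E3 := fun γ m => φ (Φ.symm (γ, m)).1 (Φ.symm (γ, m)).2

omit hsite in
/-- evaluation of the pulled-back field at an image index. [g101] -/
theorem pullback_apply (φ : Cell 2 → ℤ → E3) (X : Cell 2 × ℤ) : pullback Φ φ (Φ X).1 (Φ X).2 = φ X.1 X.2 := by
  simp only [pullback, Prod.mk.eta, Equiv.symm_apply_apply]

omit hsite in
/-- the pulled-back field vanishes off the image of the support. [g101] -/
theorem pullback_eq_zero {φ : Cell 2 → ℤ → E3} {s : Finset (Cell 2 × ℤ)} (hsφ : ∀ U : Cell 2 × ℤ, U ∉ s → φ U.1 U.2 = 0)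
    (U : Cell 2 × ℤ) (hU : U ∉ s.map Φ.toEmbedding) : pullback Φ φ U.1 U.2 = 0 := by
  have hU' : Φ.symm U ∉ s := fun hmem => hU (Finset.mem_map.mpr ⟨Φ.symm U, hmem, by simp⟩)
  simp only [pullback, Prod.mk.eta]
  exact hsφ (Φ.symm U) hU'

omit hsite in
/-- (R3) ★ ENERGY OF THE PULL-BACK: under adjacency radius `r` (`N(Y − X) ≤ 1 ⇒ N(Φ Y − Φ X) ≤ r`) the nearest-neighbour energy of a
finitely supported `φ` is at most `10 r² (2r+1)³` times that of its pull-back (regrouping §1). [g101] -/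
theorem nnFormZ_le_of_reindex {r : ℕ} (hadj : ∀ X Y : Cell 2 × ℤ, idxNorm (Y - X) ≤ 1 → idxNorm (Φ Y - Φ X) ≤ r)
    {φ : Cell 2 → ℤ → E3} {s : Finset (Cell 2 × ℤ)} (hsφ : ∀ U : Cell 2 × ℤ, U ∉ s → φ U.1 U.2 = 0) :
    nnFormZ φ ≤ 10 * (r : ℝ) ^ 2 * (2 * r + 1) ^ 3 * nnFormZ (pullback Φ φ) := by
  classical
  rw [nnFormZ_eq_sum hsφ]
  have hle : ∑ x ∈ nbSet s ×ˢ nbSet s, nnFam φ x ≤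
      ∑ y ∈ (nbSet s ×ˢ nbSet s).filter (fun x => dist x.1 x.2 ≤ 1), ‖φ y.2.1 y.2.2 - φ y.1.1 y.1.2‖ ^ 2 := by
    rw [Finset.sum_filter]
    refine Finset.sum_le_sum fun x _ => ?_
    unfold nnFam; split_ifs <;> exact le_rfl
  refine hle.trans ?_
  have himg : ∑ y ∈ (nbSet s ×ˢ nbSet s).filter (fun x => dist x.1 x.2 ≤ 1), ‖φ y.2.1 y.2.2 - φ y.1.1 y.1.2‖ ^ 2 =
      ∑ y ∈ ((nbSet s ×ˢ nbSet s).filter (fun x => dist x.1 x.2 ≤ 1)).map (Equiv.prodCongr Φ Φ).toEmbedding,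
        ‖pullback Φ φ y.2.1 y.2.2 - pullback Φ φ y.1.1 y.1.2‖ ^ 2 := by
    rw [Finset.sum_map]
    refine Finset.sum_congr rfl fun y _ => ?_
    simp only [Equiv.coe_toEmbedding, Equiv.prodCongr_apply, Prod.map_fst, Prod.map_snd]
    rw [pullback_apply Φ φ y.1, pullback_apply Φ φ y.2]
  rw [himg]
  refine sum_normSq_le_of_idxNorm_le (pullback_eq_zero Φ hsφ) r _ fun y hy => ?_
  obtain ⟨x, hx, rfl⟩ := Finset.mem_map.mp hy
  have hd : dist x.1 x.2 ≤ 1 := (Finset.mem_filter.mp hx).2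
  simp only [Equiv.coe_toEmbedding, Equiv.prodCongr_apply, Prod.map_fst, Prod.map_snd]
  refine hadj x.1 x.2 ?_
  have : (idxNorm (x.2 - x.1) : ℝ) ≤ 1 := by rw [← dist_eq_idxNorm]; exact hd
  exact_mod_cast this

/-- (R4) ★★ COERCIVITY TRANSFER: under adjacency radius `r` coercivity degrades by `10 r² (2r+1)³` (the quadratic form is invariant under
re-indexing — the kernel sees the two SITES only, `layeredKernel_sub_fst_eq`, and `Equiv.hasSum_iff (Equiv.prodCongr Φ Φ)` — then (R3)). [g101] -/
theorem coerciveZ_of_reindex {r : ℕ} (hadj : ∀ X Y : Cell 2 × ℤ, idxNorm (Y - X) ≤ 1 → idxNorm (Φ Y - Φ X) ≤ r) {κ : ℝ}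
    (hκ : 0 ≤ κ) (h : CoerciveZ (layeredKernel g₁ g₂ wf) κ) :
    CoerciveZ (layeredKernel G₁ G₂ w') (κ / (10 * (r : ℝ) ^ 2 * (2 * r + 1) ^ 3)) := by
  classical
  intro φ hφ E hE
  obtain ⟨s, hs⟩ := hφ
  have hsφ : ∀ U : Cell 2 × ℤ, U ∉ s → φ U.1 U.2 = 0 := fun U hU => hs U.1 U.2 (by simpa only [Prod.mk.eta] using hU)
  have hφf_fs : HasFiniteSupport (pullback Φ φ) := ⟨s.map Φ.toEmbedding, fun γ m hU => pullback_eq_zero Φ hsφ (γ, m) hU⟩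
  -- the summed family of `φ` is the pulled-back family re-indexed by `Φ × Φ`
  set F : (Cell 2 × ℤ) × (Cell 2 × ℤ) → ℝ := fun x =>
    ⟪pullback Φ φ x.2.1 x.2.2 - pullback Φ φ x.1.1 x.1.2,
      layeredKernel g₁ g₂ wf (x.2.1 - x.1.1) x.1.2 x.2.2 (pullback Φ φ x.2.1 x.2.2 - pullback Φ φ x.1.1 x.1.2)⟫ with hF
  have hker : ∀ x : (Cell 2 × ℤ) × (Cell 2 × ℤ), layeredKernel G₁ G₂ w' (x.2.1 - x.1.1) x.1.2 x.2.2 =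
      layeredKernel g₁ g₂ wf ((Φ x.2).1 - (Φ x.1).1) (Φ x.1).2 (Φ x.2).2 := by
    intro x
    rw [layeredKernel_sub_fst_eq G₁ G₂ w' x.1 x.2, layeredKernel_sub_fst_eq g₁ g₂ wf (Φ x.1) (Φ x.2), hsite x.1, hsite x.2]
    simp only [Φ.injective.eq_iff]
  have hfam : (fun x : (Cell 2 × ℤ) × (Cell 2 × ℤ) =>
      ⟪φ x.2.1 x.2.2 - φ x.1.1 x.1.2,
        layeredKernel G₁ G₂ w' (x.2.1 - x.1.1) x.1.2 x.2.2 (φ x.2.1 x.2.2 - φ x.1.1 x.1.2)⟫) =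
      F ∘ (Equiv.prodCongr Φ Φ) := by
    funext x
    simp only [hF, Function.comp_apply, Equiv.prodCongr_apply, Prod.map_fst, Prod.map_snd]
    rw [pullback_apply Φ φ x.1, pullback_apply Φ φ x.2, hker x]
  have hE' : HasSum F E := (Equiv.hasSum_iff (Equiv.prodCongr Φ Φ)).1 (by rw [← hfam]; exact hE)
  have hfine : κ * nnFormZ (pullback Φ φ) ≤ E / 2 := h _ hφf_fs E hE'
  have hR3 := nnFormZ_le_of_reindex Φ hadj hsφ
  have hCnn : (0 : ℝ) ≤ 10 * (r : ℝ) ^ 2 * (2 * r + 1) ^ 3 := by positivity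
  have hE0 : 0 ≤ E / 2 := (mul_nonneg hκ (nnFormZ_nonneg _)).trans hfine
  rcases hCnn.eq_or_lt with hC0 | hCpos
  · rw [← hC0, div_zero, zero_mul]; exact hE0
  · calc κ / (10 * (r : ℝ) ^ 2 * (2 * r + 1) ^ 3) * nnFormZ φ
        ≤ κ / (10 * (r : ℝ) ^ 2 * (2 * r + 1) ^ 3) * (10 * (r : ℝ) ^ 2 * (2 * r + 1) ^ 3 * nnFormZ (pullback Φ φ)) :=
          mul_le_mul_of_nonneg_left hR3 (div_nonneg hκ hCpos.le)
      _ = κ * nnFormZ (pullback Φ φ) := by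
          have hr0 : (r : ℝ) ≠ 0 := by rintro h0; rw [h0] at hCpos; norm_num at hCpos
          field_simp
      _ ≤ E / 2 := hfine

end Reindex

/-! ### §3 the index-4 twin (generators `2g₁, 2g₂`) -/

/-- the index-4 twin's site bijection: coarse index `(γ, m)` ↦ fine index `(2γ + (m % 4 % 2, m % 4 / 2), m / 4)`. [g101] -/
def twinIdx₄ : Cell 2 × ℤ ≃ Cell 2 × ℤ where
  toFun X := (![2 * X.1 0 + X.2 % 4 % 2, 2 * X.1 1 + X.2 % 4 / 2], X.2 / 4)
  invFun U := (![U.1 0 / 2, U.1 1 / 2], 4 * U.2 + (U.1 0 % 2 + 2 * (U.1 1 % 2)))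
  left_inv X := Prod.ext (funext fun j => by fin_cases j <;> simp <;> omega)
    (by simp only [Matrix.cons_val_zero, Matrix.cons_val_one]; omega)
  right_inv U := Prod.ext (funext fun j => by fin_cases j <;> simp <;> omega) (by simp only; omega)

/-- the index-4 twin's coarse layer offsets: fine offset of layer `m / 4` plus the coset representative of `m % 4`. [g101] -/
def twinOff₄ (g₁ g₂ : E3) (wf : ℤ → E3) (m : ℤ) : E3 :=
  wf (m / 4) + ((((m % 4 % 2 : ℤ)) : ℝ) • g₁ + (((m % 4 / 2 : ℤ)) : ℝ) • g₂)

/-- SITE IDENTITY of the index-4 twin. [g101] -/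
theorem lsite_twin₄ (g₁ g₂ : E3) (wf : ℤ → E3) (X : Cell 2 × ℤ) :
    lsite ((2 : ℝ) • g₁) ((2 : ℝ) • g₂) (twinOff₄ g₁ g₂ wf) X.1 X.2 = lsite g₁ g₂ wf (twinIdx₄ X).1 (twinIdx₄ X).2 := by
  simp only [lsite, twinOff₄, twinIdx₄, Equiv.coe_fn_mk, Matrix.cons_val_zero, Matrix.cons_val_one]
  push_cast
  module

/-- DILATION 7 of the index-4 twin (attained: coarse layers `m`, `m + 7` are fine-adjacent). [g101] -/
theorem idxNorm_le_twin₄ (X Y : Cell 2 × ℤ) : idxNorm (Y - X) ≤ 7 * idxNorm (twinIdx₄ Y - twinIdx₄ X) := by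
  have h0 := natAbs_fst_le_idxNorm (twinIdx₄ Y - twinIdx₄ X) 0
  have h1 := natAbs_fst_le_idxNorm (twinIdx₄ Y - twinIdx₄ X) 1
  have h2 := natAbs_snd_le_idxNorm (twinIdx₄ Y - twinIdx₄ X)
  generalize idxNorm (twinIdx₄ Y - twinIdx₄ X) = N at h0 h1 h2 ⊢
  simp only [twinIdx₄, Equiv.coe_fn_mk, Prod.fst_sub, Prod.snd_sub, Pi.sub_apply, Matrix.cons_val_zero, Matrix.cons_val_one] at h0 h1 h2
  refine idxNorm_le_iff.mpr ⟨?_, ?_, ?_⟩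
  · simp only [Prod.fst_sub, Pi.sub_apply]; omega
  · simp only [Prod.fst_sub, Pi.sub_apply]; omega
  · simp only [Prod.snd_sub]; omega

/-- ADJACENCY RADIUS 3 of the index-4 twin. [g101] -/
theorem idxNorm_twin₄_le {X Y : Cell 2 × ℤ} (h : idxNorm (Y - X) ≤ 1) : idxNorm (twinIdx₄ Y - twinIdx₄ X) ≤ 3 := by
  obtain ⟨h0, h1, h2⟩ := idxNorm_le_iff.mp h
  simp only [Prod.fst_sub, Prod.snd_sub, Pi.sub_apply] at h0 h1 h2
  refine idxNorm_le_iff.mpr ⟨?_, ?_, ?_⟩ <;>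
    simp only [twinIdx₄, Equiv.coe_fn_mk, Prod.fst_sub, Prod.snd_sub, Pi.sub_apply, Matrix.cons_val_zero, Matrix.cons_val_one] <;> omega

/-- ★ INDEX-4 TRANSFER: same set, co-Lipschitz `c/7`, coercivity `κ/30870`. [g101] -/
theorem transfer_twin₄ {g₁ g₂ : E3} {wf : ℤ → E3} {c κ : ℝ} (hc : 0 ≤ c) (hκ : 0 ≤ κ) (hcry : IsLayeredCrystal c g₁ g₂ wf)
    (hco : CoerciveZ (layeredKernel g₁ g₂ wf) κ) :
    Layered ((2 : ℝ) • g₁) ((2 : ℝ) • g₂) (twinOff₄ g₁ g₂ wf) = Layered g₁ g₂ wf ∧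
      IsLayeredCrystal (c / 7) ((2 : ℝ) • g₁) ((2 : ℝ) • g₂) (twinOff₄ g₁ g₂ wf) ∧
      CoerciveZ (layeredKernel ((2 : ℝ) • g₁) ((2 : ℝ) • g₂) (twinOff₄ g₁ g₂ wf)) (κ / 30870) := by
  refine ⟨layered_eq_of_reindex twinIdx₄ (lsite_twin₄ g₁ g₂ wf), ?_, ?_⟩
  · have h := isLayeredCrystal_of_reindex twinIdx₄ (lsite_twin₄ g₁ g₂ wf) (D := 7) (by norm_num)
      (fun X Y => idxNorm_le_twin₄ X Y) hc hcry
    exact_mod_cast h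
  · have h := coerciveZ_of_reindex twinIdx₄ (lsite_twin₄ g₁ g₂ wf) (r := 3) (fun X Y hXY => idxNorm_twin₄_le hXY) hκ hco
    norm_num at h
    exact h

/-! ### §4 the index-3 twin (generators `g₁ + g₂, −g₁ + 2g₂`) -/

/-- the index-3 twin's site bijection: coarse index `(γ, m)` ↦ fine index `((γ₀ − γ₁ + m % 3, γ₀ + 2γ₁), m / 3)`. [g101] -/
def twinIdx₃ : Cell 2 × ℤ ≃ Cell 2 × ℤ where
  toFun X := (![X.1 0 - X.1 1 + X.2 % 3, X.1 0 + 2 * X.1 1], X.2 / 3)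
  invFun U := (![U.1 1 - 2 * ((U.1 1 - U.1 0 + (U.1 0 - U.1 1) % 3) / 3), (U.1 1 - U.1 0 + (U.1 0 - U.1 1) % 3) / 3],
    3 * U.2 + (U.1 0 - U.1 1) % 3)
  left_inv X := Prod.ext (funext fun j => by fin_cases j <;> simp <;> omega)
    (by simp only [Matrix.cons_val_zero, Matrix.cons_val_one]; omega)
  right_inv U := by
    refine Prod.ext (funext fun j => ?_) (by simp only; omega)
    fin_cases j
    · simp; omega
    · simp

/-- the index-3 twin's coarse layer offsets: fine offset of layer `m / 3` plus the coset representative `(m % 3) • g₁`. [g101] -/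
def twinOff₃ (g₁ : E3) (wf : ℤ → E3) (m : ℤ) : E3 := wf (m / 3) + (((m % 3 : ℤ)) : ℝ) • g₁

/-- SITE IDENTITY of the index-3 twin. [g101] -/
theorem lsite_twin₃ (g₁ g₂ : E3) (wf : ℤ → E3) (X : Cell 2 × ℤ) :
    lsite (g₁ + g₂) (-g₁ + (2 : ℝ) • g₂) (twinOff₃ g₁ wf) X.1 X.2 = lsite g₁ g₂ wf (twinIdx₃ X).1 (twinIdx₃ X).2 := by
  simp only [lsite, twinOff₃, twinIdx₃, Equiv.coe_fn_mk, Matrix.cons_val_zero, Matrix.cons_val_one]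
  push_cast
  module

/-- DILATION 5 of the index-3 twin. [g101] -/
theorem idxNorm_le_twin₃ (X Y : Cell 2 × ℤ) : idxNorm (Y - X) ≤ 5 * idxNorm (twinIdx₃ Y - twinIdx₃ X) := by
  have h0 := natAbs_fst_le_idxNorm (twinIdx₃ Y - twinIdx₃ X) 0
  have h1 := natAbs_fst_le_idxNorm (twinIdx₃ Y - twinIdx₃ X) 1
  have h2 := natAbs_snd_le_idxNorm (twinIdx₃ Y - twinIdx₃ X)
  generalize idxNorm (twinIdx₃ Y - twinIdx₃ X) = N at h0 h1 h2 ⊢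
  simp only [twinIdx₃, Equiv.coe_fn_mk, Prod.fst_sub, Prod.snd_sub, Pi.sub_apply, Matrix.cons_val_zero, Matrix.cons_val_one] at h0 h1 h2
  -- integrality step made explicit (omega has no dark shadow): `3·|Δγ₁| ≤ 2N + 2`, and the case `N = 0`
  have hB : 3 * (Y.1 1 - X.1 1).natAbs ≤ 2 * N + 2 := by omega
  refine idxNorm_le_iff.mpr ⟨?_, ?_, ?_⟩
  · simp only [Prod.fst_sub, Pi.sub_apply]
    rcases Nat.eq_zero_or_pos N with rfl | hN <;> omega
  · simp only [Prod.fst_sub, Pi.sub_apply]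
    rcases Nat.eq_zero_or_pos N with rfl | hN <;> omega
  · simp only [Prod.snd_sub]
    rcases Nat.eq_zero_or_pos N with rfl | hN <;> omega

/-- ADJACENCY RADIUS 4 of the index-3 twin. [g101] -/
theorem idxNorm_twin₃_le {X Y : Cell 2 × ℤ} (h : idxNorm (Y - X) ≤ 1) : idxNorm (twinIdx₃ Y - twinIdx₃ X) ≤ 4 := by
  obtain ⟨h0, h1, h2⟩ := idxNorm_le_iff.mp h
  simp only [Prod.fst_sub, Prod.snd_sub, Pi.sub_apply] at h0 h1 h2
  refine idxNorm_le_iff.mpr ⟨?_, ?_, ?_⟩ <;>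
    simp only [twinIdx₃, Equiv.coe_fn_mk, Prod.fst_sub, Prod.snd_sub, Pi.sub_apply, Matrix.cons_val_zero, Matrix.cons_val_one] <;> omega

/-- ★ INDEX-3 TRANSFER: same set, co-Lipschitz `c/5`, coercivity `κ/116640`. [g101] -/
theorem transfer_twin₃ {g₁ g₂ : E3} {wf : ℤ → E3} {c κ : ℝ} (hc : 0 ≤ c) (hκ : 0 ≤ κ) (hcry : IsLayeredCrystal c g₁ g₂ wf)
    (hco : CoerciveZ (layeredKernel g₁ g₂ wf) κ) :
    Layered (g₁ + g₂) (-g₁ + (2 : ℝ) • g₂) (twinOff₃ g₁ wf) = Layered g₁ g₂ wf ∧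
      IsLayeredCrystal (c / 5) (g₁ + g₂) (-g₁ + (2 : ℝ) • g₂) (twinOff₃ g₁ wf) ∧
      CoerciveZ (layeredKernel (g₁ + g₂) (-g₁ + (2 : ℝ) • g₂) (twinOff₃ g₁ wf)) (κ / 116640) := by
  refine ⟨layered_eq_of_reindex twinIdx₃ (lsite_twin₃ g₁ g₂ wf), ?_, ?_⟩
  · have h := isLayeredCrystal_of_reindex twinIdx₃ (lsite_twin₃ g₁ g₂ wf) (D := 5) (by norm_num)
      (fun X Y => idxNorm_le_twin₃ X Y) hc hcry
    exact_mod_cast h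
  · have h := coerciveZ_of_reindex twinIdx₃ (lsite_twin₃ g₁ g₂ wf) (r := 4) (fun X Y hXY => idxNorm_twin₃_le hXY) hκ hco
    norm_num at h
    exact h

/-! ### §5 the cell-identification leaf and the coarse re-chart -/

/-- the two TWIN RELATIONS between the generator pairs of a coarse chart `L` and a fine chart `Lf`: index 4 (`gen L = 2·gen Lf`) or
index 3 (`gen L = √3·R₃₀ (gen Lf)`, written on the triangular basis). [g101] -/
def IsTwinGen (L Lf : E3 ≃L[ℝ] E3) : Prop :=
  (gen₁ L = (2 : ℝ) • gen₁ Lf ∧ gen₂ L = (2 : ℝ) • gen₂ Lf) ∨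
    (gen₁ L = gen₁ Lf + gen₂ Lf ∧ gen₂ L = -gen₁ Lf + (2 : ℝ) • gen₂ Lf)

/-- ★ THE CELL-IDENTIFICATION LEAF (CELL-ID · WEAKER · UNDECIDED; test PLANE-COMPLETE from `IsTwoShellGoodSet (1/16) (9/10) 1`): every
equilibrium chart `(L, w)` at a coarse scale `a ∈ Wc` has a FINE equilibrium chart `(Lf, wf)` at a scale `af ∈ Wf` with the same atom set and
twin-related generators (`Lf := L ∘ M⁻¹`, `M` the index-4 or index-3 sublattice map; conformal at `a/2` resp. `a/√3`). [g101] -/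
def TwinChartP (s Λ : ℝ) (Wf Wc : Set ℝ) : Prop :=
  ∀ a : ℝ, a ∈ Wc → 0 < a → ∀ (L : E3 ≃L[ℝ] E3) (w : ℤ → E3), IsEquilChart a s Λ L w →
    ∃ af : ℝ, af ∈ Wf ∧ 0 < af ∧ ∃ (Lf : E3 ≃L[ℝ] E3) (wf : ℤ → E3), IsEquilChart af s Λ Lf wf ∧
      LayeredHom (Lf : E3 →L[ℝ] E3) wf = LayeredHom (L : E3 →L[ℝ] E3) w ∧ IsTwinGen L Lf

/-- ★★ THE COARSE RE-CHART from the cell-identification leaf: fine windowed stability re-indexes, through the twin of the fine chart, into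
coarse windowed stability with constants `(κ₀/116640, c₀/7)` (the worse of the index-3 and index-4 constants). [g101] -/
theorem coarseRechartP_of_twinChart {s Λ κ₀ c₀ : ℝ} {Wf Wc : Set ℝ} (hκ : 0 ≤ κ₀) (hc : 0 ≤ c₀) (hT : TwinChartP s Λ Wf Wc) :
    CoarseRechartP s Λ κ₀ c₀ (κ₀ / 116640) (c₀ / 7) Wf Wc := by
  intro hfine a ha ha0 L w hE
  obtain ⟨af, haf, haf0, Lf, wf, hEf, hhom, htwin⟩ := hT a ha ha0 L w hE
  obtain ⟨wf', hlay, hcry, hco⟩ := hfine af haf haf0 Lf wf hEf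
  have hlay' : Layered (gen₁ Lf) (gen₂ Lf) wf' = LayeredHom (Lf : E3 →L[ℝ] E3) wf := hlay
  have hcry' : IsLayeredCrystal c₀ (gen₁ Lf) (gen₂ Lf) wf' := hcry
  have hco' : CoerciveZ (layeredKernel (gen₁ Lf) (gen₂ Lf) wf') κ₀ := hco
  show ∃ w' : ℤ → E3, Layered (gen₁ L) (gen₂ L) w' = LayeredHom (L : E3 →L[ℝ] E3) w ∧ IsLayeredCrystal (c₀ / 7) (gen₁ L) (gen₂ L) w' ∧
    CoerciveZ (layeredKernel (gen₁ L) (gen₂ L) w') (κ₀ / 116640)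
  rcases htwin with ⟨h1, h2⟩ | ⟨h1, h2⟩
  · obtain ⟨hL, hC, hK⟩ := transfer_twin₄ hc hκ hcry' hco'
    refine ⟨twinOff₄ (gen₁ Lf) (gen₂ Lf) wf', ?_, ?_, ?_⟩
    · rw [h1, h2, hL, hlay', hhom]
    · rw [h1, h2]; exact hC
    · rw [h1, h2]
      exact hK.of_le (by
        have : κ₀ / 116640 ≤ κ₀ / 30870 := div_le_div_of_nonneg_left hκ (by norm_num) (by norm_num)
        exact this)
  · obtain ⟨hL, hC, hK⟩ := transfer_twin₃ hc hκ hcry' hco'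
    refine ⟨twinOff₃ (gen₁ Lf) wf', ?_, ?_, ?_⟩
    · rw [h1, h2, hL, hlay', hhom]
    · rw [h1, h2]
      exact hC.of_le (by
        have : c₀ / 7 ≤ c₀ / 5 := div_le_div_of_nonneg_left hc (by norm_num) (by norm_num)
        exact this)
    · rw [h1, h2]; exact hK

/-- ★★ THE BINDER FROM THE FINE WINDOW: fine windowed stability + the cell-identification leaf on the coarse window + the scale cover ⇒
`UniformEquilStabilityAt` with constants `(min κ₀ (κ₀/116640), min c₀ (c₀/7))` (ZZZYRE `uniformEquilStabilityAt_of_fine_coarse`). [g101] -/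
theorem uniformEquilStabilityAt_of_fine_twin {s Λ κ₀ c₀ : ℝ} {Wf Wc : Set ℝ} (hκ : 0 ≤ κ₀) (hc : 0 ≤ c₀)
    (hfine : UniformEquilStabilityAtIn s Λ κ₀ c₀ Wf) (hT : TwinChartP s Λ Wf Wc) (hcov : ChartScaleCoverP s Λ Wf Wc) :
    UniformEquilStabilityAt s Λ (min κ₀ (κ₀ / 116640)) (min c₀ (c₀ / 7)) :=
  uniformEquilStabilityAt_of_fine_coarse hfine (coarseRechartP_of_twinChart hκ hc hT) hcov

/-- ★ DESIGNATE of line (D) (r1891 binder of record): at `(s, Λ, c₀) = (1/50, 2, 1/2)` — the windows `Wf`, `Wc` stay parameters (their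
literals `Icc amin amax`, `(√3·Wf ∪ 2·Wf) ∩ {a (1 − s) ≤ 2}` are PROVISIONAL until amin/amax are derived from `IsClean`'s `(1/16, 9/10, 1)`). [g101] -/
theorem uniformEquilStabilityAt_designate {κ₀ : ℝ} {Wf Wc : Set ℝ} (hκ : 0 ≤ κ₀)
    (hfine : UniformEquilStabilityAtIn (1 / 50) 2 κ₀ (1 / 2) Wf) (hT : TwinChartP (1 / 50) 2 Wf Wc)
    (hcov : ChartScaleCoverP (1 / 50) 2 Wf Wc) : UniformEquilStabilityAt (1 / 50) 2 (min κ₀ (κ₀ / 116640)) (min (1 / 2) (1 / 14)) := by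
  have h14 : (min (1 / 2) (1 / 14) : ℝ) = min (1 / 2) (1 / 2 / 7) := by norm_num
  rw [h14]
  exact uniformEquilStabilityAt_of_fine_twin hκ (by norm_num) hfine hT hcov

end Summit.AtomisticToContinuum.Crystallization.Theorems.ChartedZeroExcessLayeredLatticeLiouville
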